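import Summits.QuantumFields.YangMills.Theorems.UnitScaleTiltProp7SkewBumpProfile
import HarnessLib

/-!
# Route `UnitScaleTilt`, crux K1 «MinimiserStabilityRegPr» (stmt-QuantumFields-19200), EX face — K-storey (px12 g16 LOCATE-K137), pen (K1b-a) (px13 g15; LOCATE #43 §6 (F2a)) —
# **THE FLAT TUBE SUM OF A BLOCK-PROFILE FIELD**: for ANY one-dimensional weights `p, τ : ℕ → ℝ` and any block datum `M`, the one-stroke tube `Σ_rΣ_{t<ℓ}` of the coarse bond `(z, μ)`
# ([Balaban1984PropagatorsI] (1.18)) applied to `x ↦ p(off_μ x)·Π_{ν≠μ}τ(off_ν x) • M(B^k x)` equals `(OWN·T^{d−1}) • M z + (SPILL·T^{d−1}) • M(z + e_μ)`,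
# `OWN = Σ_{s<ℓ}(s+1)p(s)`, `SPILL = Σ_{s<ℓ}(ℓ−1−s)p(s)`, `T = Σ_{a<ℓ}τ(a)` — the own block is read with the tent weight `s + 1`, the next block with `ℓ − 1 − s`

Cell `ym3-torus` (HUMAN RULING D-0037; rung R3 = SU(2) YM₃ on T³ — NOT d = 4, NOT infinite volume, NOT a mass gap, NOT Clay).  Width seat `ym3-torus-px13` (gen 15).  THEOREMS ONLY
(0 `def`, 0 `sorry`); `--supports stmt-QuantumFields-19200 --as helper`; count-neutral; pure lattice arithmetic (generic `P`, level `k ≤ m + K`), nothing of Bałaban's asserted.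

THE POINT (LOCATE #43 §3∕§6).  With ✓`Prop7SkewBumpProfile.sum_tube_split` the tube of `(z, μ)` is the own-block part (`r_μ + t < ℓ`, site `fibreSite z (r_μ ↦ r_μ + t)`) plus the spill-block part
(`r_μ + t ≥ ℓ`, site `fibreSite (z + e_μ) (r_μ ↦ r_μ + t − ℓ)`); a block site `fibreSite z r'` has offsets `r'` (✓`val_fibreSite`) and block `z` (✓`iterBlockOf_fibreSite`); the product over
directions factorises (`Fintype.prod_sum`), and along the line the pairs `(a, t)` with `a + t = s` number `s + 1` (own) while those with `a + t − ℓ = s` number `ℓ − 1 − s` (spill).  This is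
the flat half of (K1b-a)'s row (a): with `p` the skew profile of ✓`Prop7SkewBumpProfile` (`3·SPILL ≤ OWN`) and `τ` px10 g9's parabola (✓`Prop7CovariantBlockBumpsProfile.sum_fin_tau_eq`),
`η•QTwS 1 X` of the bump reproduces the coarse datum on the own bond and spills at most a third onto the neighbour (✓`QTwS_one_apply`, ✓`sum_tube_eq_smul_bondAvgIter`).

WHAT IS PROVED (ns `…Theorems.Prop7BlockProfileTubeSums`).
* §1 `offset_fibreSite` (`(fibreSite z r ν).val % ℓ = r ν`); `sum_line_own` (`Σ_{a<ℓ}Σ_{t<ℓ}[a+t<ℓ]·f(a+t) = Σ_{s<ℓ}(s+1)·f(s)`); `sum_line_spill`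
  (`Σ_{a<ℓ}Σ_{t<ℓ}[ℓ ≤ a+t]·f(a+t−ℓ) = Σ_{s<ℓ}(ℓ−1−s)·f(s)`); `sum_pi_mul_prod_erase` (`Σ_r F(r μ)·Π_{ν≠μ}G(r ν) = (ΣF)·(ΣG)^{d−1}`).
* §2 ★★ `sum_tube_blockProfile` (the title identity).
HONEST SCOPE.  Arithmetic; the bump, row (a), (s1)∕(s2), (K1b), K137, EX and the crux are NOT proved here.

References: T. Bałaban, CMP **95** (1984) 17–40 [Balaban1984PropagatorsI] ((1.6)–(1.7) p.18, (1.11), (1.18) pp.19–20).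
-/

set_option autoImplicit false

noncomputable section

open scoped BigOperators

namespace Summit.QuantumFields.YangMills.Theorems.Prop7BlockProfileTubeSums

open Literature.MathematicalPhysics.QuantumFieldTheory.Balaban1983to89
open Finset T4Continuum BlockAveraging LatticeFieldCalculus B1RG242Torus
open B5Eq118OneStroke (iterBlockOf)
open Summit.QuantumFields.YangMills.Theorems.Prop7CombGauge (iterBlockOf_fibreSite)
open Summit.QuantumFields.YangMills.Theorems.Prop7FlatHolonomy (sitesPerDir_zero_eq_mul_pow)
open Summit.QuantumFields.YangMills.Theorems.Prop7SkewBumpProfile (sum_tube_split)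

/-! ## §1 Offsets of block sites, the two line counts, the product-sum factorisation -/

section Lemmas

variable {P : Params} {k : ℕ}

/-- **THE OFFSETS OF A BLOCK SITE**: `(fibreSite 0 k z r ν).val mod ℓ = r ν` (standing range; ✓`val_fibreSite`). [cite: Balaban1984PropagatorsI, (1.6) p.18] -/
theorem offset_fibreSite (hk : k ≤ P.m + P.K) (z : Site P k) (r : Fin P.d → Fin (P.L ^ k)) (ν : Fin P.d) :
    ((Site.fibreSite 0 k z r) ν).val % P.L ^ k = (r ν : ℕ) := by
  have h : P.sitesPerDir 0 = P.L ^ k * P.sitesPerDir k := by rw [sitesPerDir_zero_eq_mul_pow hk, mul_comm]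
  rw [Site.val_fibreSite h, Nat.mul_add_mod', Nat.mod_eq_of_lt (r ν).isLt]

/-- **THE OWN LINE COUNT**: `Σ_{a<ℓ}Σ_{t<ℓ} [a + t < ℓ]·f(a + t) = Σ_{s<ℓ} (s + 1)·f(s)` (the pairs `(a,t)` with `a + t = s` number `s + 1`). [cite: Balaban1984PropagatorsI, (1.11) p.19] -/
theorem sum_line_own {M : Type*} [AddCommMonoid M] [Module ℝ M] (ℓ : ℕ) (f : ℕ → M) :
    ∑ a ∈ range ℓ, ∑ t ∈ range ℓ, (if a + t < ℓ then f (a + t) else 0) = ∑ s ∈ range ℓ, ((s : ℝ) + 1) • f s := by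
  classical
  -- both sides as sums over filtered pairs
  have hL : ∑ a ∈ range ℓ, ∑ t ∈ range ℓ, (if a + t < ℓ then f (a + t) else 0)
      = ∑ x ∈ (range ℓ ×ˢ range ℓ).filter (fun x : ℕ × ℕ => x.1 + x.2 < ℓ), f (x.1 + x.2) := by
    rw [Finset.sum_filter, Finset.sum_product]
  have hR : ∑ s ∈ range ℓ, ((s : ℝ) + 1) • f s
      = ∑ y ∈ (range ℓ ×ˢ range ℓ).filter (fun y : ℕ × ℕ => y.2 ≤ y.1), f y.1 := by
    rw [Finset.sum_filter, Finset.sum_product]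
    refine Finset.sum_congr rfl fun s hs => ?_
    rw [Finset.mem_range] at hs
    dsimp only
    rw [← Finset.sum_filter]
    have hfilt : (range ℓ).filter (fun a => a ≤ s) = range (s + 1) := by
      ext a; simp only [Finset.mem_filter, Finset.mem_range]; omega
    rw [hfilt, Finset.sum_const, Finset.card_range, ← Nat.cast_smul_eq_nsmul ℝ]
    push_cast; rfl
  rw [hL, hR]
  refine Finset.sum_nbij' (fun x => (x.1 + x.2, x.1)) (fun y => (y.2, y.1 - y.2)) ?_ ?_ ?_ ?_ ?_
  · intro x hx
    simp only [Finset.mem_filter, Finset.mem_product, Finset.mem_range] at hx ⊢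
    omega
  · intro y hy
    simp only [Finset.mem_filter, Finset.mem_product, Finset.mem_range] at hy ⊢
    omega
  · intro x hx
    simp only [Finset.mem_filter, Finset.mem_product, Finset.mem_range] at hx
    ext <;> simp
  · intro y hy
    simp only [Finset.mem_filter, Finset.mem_product, Finset.mem_range] at hy
    ext <;> simp
    omega
  · intro x _; rfl

/-- **THE SPILL LINE COUNT**: `Σ_{a<ℓ}Σ_{t<ℓ} [ℓ ≤ a + t]·f(a + t − ℓ) = Σ_{s<ℓ} (ℓ − 1 − s)·f(s)` (the pairs with `a + t − ℓ = s` number `ℓ − 1 − s`). [cite: Balaban1984PropagatorsI, (1.11) p.19] -/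
theorem sum_line_spill {M : Type*} [AddCommMonoid M] [Module ℝ M] (ℓ : ℕ) (f : ℕ → M) :
    ∑ a ∈ range ℓ, ∑ t ∈ range ℓ, (if a + t < ℓ then 0 else f (a + t - ℓ)) = ∑ s ∈ range ℓ, ((ℓ : ℝ) - 1 - s) • f s := by
  classical
  have hL : ∑ a ∈ range ℓ, ∑ t ∈ range ℓ, (if a + t < ℓ then 0 else f (a + t - ℓ))
      = ∑ x ∈ (range ℓ ×ˢ range ℓ).filter (fun x : ℕ × ℕ => ¬ (x.1 + x.2 < ℓ)), f (x.1 + x.2 - ℓ) := by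
    rw [Finset.sum_filter, Finset.sum_product]
    refine Finset.sum_congr rfl fun a _ => Finset.sum_congr rfl fun t _ => ?_
    by_cases h : a + t < ℓ <;> simp [h]
  have hR : ∑ s ∈ range ℓ, ((ℓ : ℝ) - 1 - s) • f s
      = ∑ y ∈ (range ℓ ×ˢ range ℓ).filter (fun y : ℕ × ℕ => y.1 < y.2), f y.1 := by
    rw [Finset.sum_filter, Finset.sum_product]
    refine Finset.sum_congr rfl fun s hs => ?_
    rw [Finset.mem_range] at hs
    dsimp only
    rw [← Finset.sum_filter]
    have hfilt : (range ℓ).filter (fun a => s < a) = Finset.Ico (s + 1) ℓ := by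
      ext a; simp only [Finset.mem_filter, Finset.mem_range, Finset.mem_Ico]; omega
    rw [hfilt, Finset.sum_const, Nat.card_Ico, ← Nat.cast_smul_eq_nsmul ℝ, Nat.cast_sub (by omega : s + 1 ≤ ℓ)]
    push_cast; ring_nf
  rw [hL, hR]
  refine Finset.sum_nbij' (fun x => (x.1 + x.2 - ℓ, x.1)) (fun y => (y.2, y.1 + ℓ - y.2)) ?_ ?_ ?_ ?_ ?_
  · intro x hx
    simp only [Finset.mem_filter, Finset.mem_product, Finset.mem_range] at hx ⊢
    omega
  · intro y hy
    simp only [Finset.mem_filter, Finset.mem_product, Finset.mem_range] at hy ⊢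
    omega
  · intro x hx
    simp only [Finset.mem_filter, Finset.mem_product, Finset.mem_range] at hx
    ext <;> simp
    omega
  · intro y hy
    simp only [Finset.mem_filter, Finset.mem_product, Finset.mem_range] at hy
    ext <;> simp
    omega
  · intro x _; rfl

/-- **PRODUCT-SUM FACTORISATION WITH ONE DISTINGUISHED DIRECTION**: `Σ_{r : Fin d → Fin ℓ} F(r μ)·Π_{ν ≠ μ} G(r ν) = (Σ_a F a)·(Σ_a G a)^{d−1}` (`Fintype.prod_sum`). [folklore] -/
theorem sum_pi_mul_prod_erase {d ℓ : ℕ} (μ : Fin d) (F G : Fin ℓ → ℝ) :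
    ∑ r : Fin d → Fin ℓ, F (r μ) * ∏ ν ∈ univ.erase μ, G (r ν) = (∑ a : Fin ℓ, F a) * (∑ a : Fin ℓ, G a) ^ (d - 1) := by
  classical
  have h := Fintype.prod_sum (fun (ν : Fin d) (a : Fin ℓ) => Function.update (fun _ : Fin d => G) μ F ν a)
  -- left: `Π_ν Σ_a H ν a = (Σ F)·(Σ G)^{d−1}`
  have hl : ∏ ν : Fin d, ∑ a : Fin ℓ, Function.update (fun _ : Fin d => G) μ F ν a = (∑ a : Fin ℓ, F a) * (∑ a : Fin ℓ, G a) ^ (d - 1) := by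
    rw [← mul_prod_erase univ _ (mem_univ μ), Function.update_self]
    congr 1
    rw [Finset.prod_congr rfl fun ν hν => by rw [Function.update_of_ne (ne_of_mem_erase hν)], prod_const, card_erase_of_mem (mem_univ μ),
      card_univ, Fintype.card_fin]
  -- right: `Σ_r Π_ν H ν (r ν) = Σ_r F(r μ)·Π_{ν≠μ} G(r ν)`
  have hr : ∑ r : Fin d → Fin ℓ, ∏ ν : Fin d, Function.update (fun _ : Fin d => G) μ F ν (r ν) = ∑ r : Fin d → Fin ℓ, F (r μ) * ∏ ν ∈ univ.erase μ, G (r ν) := by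
    refine Finset.sum_congr rfl fun r _ => ?_
    rw [← mul_prod_erase univ _ (mem_univ μ), Function.update_self]
    congr 1
    exact Finset.prod_congr rfl fun ν hν => by rw [Function.update_of_ne (ne_of_mem_erase hν)]
  rw [← hr, ← h, hl]

end Lemmas

/-! ## §2 ★★ The tube sum of a block-profile field -/

section Tube

variable {P : Params} {k : ℕ}

/-- ★★ **THE FLAT TUBE SUM OF A BLOCK-PROFILE FIELD**: for weights `p, τ : ℕ → ℝ`, a block datum `M : Site P k → V` and the coarse bond `(z, μ)` (standing range):
`Σ_r Σ_{t<ℓ} (p(off_μ x_{r,t})·Π_{ν≠μ} τ(off_ν x_{r,t})) • M(B^k x_{r,t}) = (OWN·T^{d−1}) • M z + (SPILL·T^{d−1}) • M(z + e_μ)`, `x_{r,t} = fibreSite z r + te_μ`, `off_ν x = x_ν mod ℓ`,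
`OWN = Σ_{s<ℓ}(s+1)p(s)`, `SPILL = Σ_{s<ℓ}(ℓ−1−s)p(s)`, `T = Σ_{a<ℓ}τ(a)` — the own block carries the tent weight `s+1`, the next block `ℓ−1−s`.
[cite: Balaban1984PropagatorsI, (1.11), (1.18) pp.19-20] -/
theorem sum_tube_blockProfile (hk : k ≤ P.m + P.K) {V : Type*} [AddCommGroup V] [Module ℝ V] (p τ : ℕ → ℝ) (M : Site P k → V) (z : Site P k) (μ : Fin P.d) :
    ∑ r : Fin P.d → Fin (P.L ^ k), ∑ t ∈ range (P.L ^ k),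
        (p (((runSite (Site.fibreSite 0 k z r) μ t) μ).val % P.L ^ k) * ∏ ν ∈ univ.erase μ, τ (((runSite (Site.fibreSite 0 k z r) μ t) ν).val % P.L ^ k))
          • M (iterBlockOf k (runSite (Site.fibreSite 0 k z r) μ t))
      = ((∑ s ∈ range (P.L ^ k), ((s : ℝ) + 1) * p s) * (∑ a ∈ range (P.L ^ k), τ a) ^ (P.d - 1)) • M z
        + ((∑ s ∈ range (P.L ^ k), ((P.L ^ k : ℕ) - 1 - (s : ℝ)) * p s) * (∑ a ∈ range (P.L ^ k), τ a) ^ (P.d - 1)) • M (z.shift μ) := by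
  classical
  have h : P.sitesPerDir 0 = P.L ^ k * P.sitesPerDir k := by rw [sitesPerDir_zero_eq_mul_pow hk, mul_comm]
  -- the profile as a site function times the block datum
  set g : Site P 0 → V := fun x => (p ((x μ).val % (P.L ^ k)) * ∏ ν ∈ univ.erase μ, τ ((x ν).val % (P.L ^ k))) • M (iterBlockOf k x) with hg
  have hsplit := sum_tube_split hk g z μ
  -- evaluate `g` at block sites: offsets `r'`, block `z'`
  have hgval : ∀ (z' : Site P k) (r' : Fin P.d → Fin (P.L ^ k)), g (Site.fibreSite 0 k z' r') = (p (r' μ) * ∏ ν ∈ univ.erase μ, τ (r' ν)) • M z' := by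
    intro z' r'
    simp only [hg, offset_fibreSite hk, iterBlockOf_fibreSite hk h]
  -- the per-term evaluations
  have hown_term : ∀ (r : Fin P.d → Fin (P.L ^ k)) (t : ℕ),
      (if ht : (r μ : ℕ) + t < (P.L ^ k) then g (Site.fibreSite 0 k z (Function.update r μ ⟨r μ + t, ht⟩)) else 0)
        = ((if (r μ : ℕ) + t < (P.L ^ k) then p ((r μ : ℕ) + t) else 0) * ∏ ν ∈ univ.erase μ, τ (r ν)) • M z := by
    intro r t
    by_cases ht : (r μ : ℕ) + t < (P.L ^ k)
    · rw [dif_pos ht, if_pos ht, hgval]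
      congr 2
      · rw [Function.update_self]
      · exact Finset.prod_congr rfl fun ν hν => by rw [Function.update_of_ne (ne_of_mem_erase hν)]
    · rw [dif_neg ht, if_neg ht, zero_mul, zero_smul]
  have hspill_term : ∀ (r : Fin P.d → Fin (P.L ^ k)) (t : ℕ), t < (P.L ^ k) →
      (if (r μ : ℕ) + t < (P.L ^ k) then (0 : V) else
          g (Site.fibreSite 0 k (z.shift μ) (Function.update r μ ⟨(r μ + t - (P.L ^ k)) % (P.L ^ k), Nat.mod_lt _ (pow_pos P.L_pos k)⟩)))
        = ((if (r μ : ℕ) + t < (P.L ^ k) then 0 else p ((r μ : ℕ) + t - (P.L ^ k))) * ∏ ν ∈ univ.erase μ, τ (r ν)) • M (z.shift μ) := by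
    intro r t htℓ
    by_cases ht : (r μ : ℕ) + t < (P.L ^ k)
    · rw [if_pos ht, if_pos ht, zero_mul, zero_smul]
    · rw [if_neg ht, if_neg ht, hgval]
      have hmod : ((r μ : ℕ) + t - (P.L ^ k)) % (P.L ^ k) = (r μ : ℕ) + t - (P.L ^ k) := Nat.mod_eq_of_lt (by have := (r μ).isLt; omega)
      congr 2
      · rw [Function.update_self]; exact congrArg p hmod
      · exact Finset.prod_congr rfl fun ν hν => by rw [Function.update_of_ne (ne_of_mem_erase hν)]
  -- the two scalar sums
  have hOWN : ∑ r : Fin P.d → Fin (P.L ^ k), ∑ t ∈ range (P.L ^ k), ((if (r μ : ℕ) + t < (P.L ^ k) then p ((r μ : ℕ) + t) else 0) * ∏ ν ∈ univ.erase μ, τ (r ν))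
      = (∑ s ∈ range (P.L ^ k), ((s : ℝ) + 1) * p s) * (∑ a ∈ range (P.L ^ k), τ a) ^ (P.d - 1) := by
    simp_rw [← Finset.sum_mul]
    rw [sum_pi_mul_prod_erase μ (fun a : Fin (P.L ^ k) => ∑ t ∈ range (P.L ^ k), (if (a : ℕ) + t < (P.L ^ k) then p ((a : ℕ) + t) else 0)) (fun a : Fin (P.L ^ k) => τ (a : ℕ)),
      Fin.sum_univ_eq_sum_range (fun a : ℕ => ∑ t ∈ range (P.L ^ k), (if a + t < (P.L ^ k) then p (a + t) else 0)) (P.L ^ k),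
      Fin.sum_univ_eq_sum_range (fun a : ℕ => τ a) (P.L ^ k), sum_line_own (P.L ^ k) p]
    simp only [smul_eq_mul]
  have hSPILL : ∑ r : Fin P.d → Fin (P.L ^ k), ∑ t ∈ range (P.L ^ k), ((if (r μ : ℕ) + t < (P.L ^ k) then 0 else p ((r μ : ℕ) + t - (P.L ^ k))) * ∏ ν ∈ univ.erase μ, τ (r ν))
      = (∑ s ∈ range (P.L ^ k), (((P.L ^ k) : ℕ) - 1 - (s : ℝ)) * p s) * (∑ a ∈ range (P.L ^ k), τ a) ^ (P.d - 1) := by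
    simp_rw [← Finset.sum_mul]
    rw [sum_pi_mul_prod_erase μ (fun a : Fin (P.L ^ k) => ∑ t ∈ range (P.L ^ k), (if (a : ℕ) + t < (P.L ^ k) then 0 else p ((a : ℕ) + t - (P.L ^ k)))) (fun a : Fin (P.L ^ k) => τ (a : ℕ)),
      Fin.sum_univ_eq_sum_range (fun a : ℕ => ∑ t ∈ range (P.L ^ k), (if a + t < (P.L ^ k) then 0 else p (a + t - (P.L ^ k)))) (P.L ^ k),
      Fin.sum_univ_eq_sum_range (fun a : ℕ => τ a) (P.L ^ k), sum_line_spill (P.L ^ k) p]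
    simp only [smul_eq_mul]
  -- assemble
  show (∑ r : Fin P.d → Fin (P.L ^ k), ∑ t ∈ range (P.L ^ k), g (runSite (Site.fibreSite 0 k z r) μ t)) = _
  rw [hsplit]
  have h1 : ∑ r : Fin P.d → Fin (P.L ^ k), ∑ t ∈ range (P.L ^ k),
      (if ht : (r μ : ℕ) + t < (P.L ^ k) then g (Site.fibreSite 0 k z (Function.update r μ ⟨r μ + t, ht⟩)) else 0)
      = ((∑ s ∈ range (P.L ^ k), ((s : ℝ) + 1) * p s) * (∑ a ∈ range (P.L ^ k), τ a) ^ (P.d - 1)) • M z := by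
    rw [← hOWN, Finset.sum_smul]
    refine Finset.sum_congr rfl fun r _ => ?_
    rw [Finset.sum_smul]
    exact Finset.sum_congr rfl fun t _ => hown_term r t
  have h2 : ∑ r : Fin P.d → Fin (P.L ^ k), ∑ t ∈ range (P.L ^ k),
      (if (r μ : ℕ) + t < (P.L ^ k) then (0 : V) else
          g (Site.fibreSite 0 k (z.shift μ) (Function.update r μ ⟨(r μ + t - (P.L ^ k)) % (P.L ^ k), Nat.mod_lt _ (pow_pos P.L_pos k)⟩)))
      = ((∑ s ∈ range (P.L ^ k), (((P.L ^ k) : ℕ) - 1 - (s : ℝ)) * p s) * (∑ a ∈ range (P.L ^ k), τ a) ^ (P.d - 1)) • M (z.shift μ) := by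
    rw [← hSPILL, Finset.sum_smul]
    refine Finset.sum_congr rfl fun r _ => ?_
    rw [Finset.sum_smul]
    exact Finset.sum_congr rfl fun t ht => hspill_term r t (Finset.mem_range.mp ht)
  rw [h1, h2]

end Tube

end Summit.QuantumFields.YangMills.Theorems.Prop7BlockProfileTubeSums

end
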